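import Summits.QuantumFields.YangMills.Theorems.IsotropyFromPowerCountingTemperedCurvatureMomentsThreePointChartBoundsPartTwoCore

/-!
# Three-point chart bounds — stub `stub_threePointChartBounds` (B) of crux `TemperedCurvatureMoments`

Stub B of reshape 4 of the registered skeleton `Cruxes/TemperedCurvatureMoments/Lines/Sketch.lean`
(crux stmt-QuantumFields-17721, line `Sketch`), registered signature verbatim, with part 2 of the proof
(`exists_frame_pairPSD`, `part_two`: disjoint pairs in the diagonal frames from diagonal product reflection
positivity).  Parts I–X: `…ThreePointChartBoundsSpectral/TwoPoint/Translation/Pair/Standard/Frames/PartOne/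
ProductRP/PairPSD/PartTwoCore`.  HONEST LABEL: one registered analysis stub of one line of crux T; registry progress
only — T, the route and the Yang–Mills mass gap remain open.
References: Osterwalder–Schrader, Comm. Math. Phys. 31 (1973) §4.1, 42 (1975) §4; Glimm–Jaffe, Quantum
Physics (1987) Thm. 6.1.3, §19.5. [folklore]
-/

noncomputable section

open scoped InnerProductSpace ComplexConjugate
open MeasureTheory Filter Set Complex
open _root_.Topology
open Literature.MathematicalPhysics.AQFT Literature.MathematicalPhysics.QuantumLattice
open Literature.MathematicalPhysics.QuantumFieldTheory
open scoped SchwartzMap LineDeriv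
open Literature.MathematicalPhysics.QuantumLattice.SchwingerFamily (timeVec)
open Summit.QuantumFields.YangMills.Theorems.CurvatureKernel
open Summit.QuantumFields.YangMills.Cruxes.PlanarSpectralCone.TwoMirrorLightconeSlots.DiscSections (translateMulti_time_space)

namespace Summit.QuantumFields.YangMills.Theorems.TemperedCurvatureMoments.Sketch.ThreePointChartBounds

/-! ## Part 2 of the stub: disjoint pairs in the diagonal lattice frames -/

section PartTwo

open Summit.QuantumFields.YangMills.Theorems.CurvatureBoostCovariance.Negative
  (OSPackage Translations Hypercubic EightFrameRP)

variable (S₁ : SchwingerFamily (EuclideanSpace ℝ (Fin 4)))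

/-- **A diagonal frame as `R₀ ∘ P`** with `R₀` the `45°` frame of the `(x₀,x₁)`-plane and `P` a proper signed
permutation; the pair Gram property of `𝔖 ∘ linActMulti (R₀.trans P)` follows from product reflection
positivity in the frame `R₀` and invariance of `𝔖` under `P` on `⁰𝒮`. [folklore] -/
theorem exists_frame_pairPSD (hhyp : Hypercubic S₁)
    (hPRP : ∀ (R : EuclideanSpace ℝ (Fin 4) ≃ₗᵢ[ℝ] EuclideanSpace ℝ (Fin 4)) (a b : ℝ), a ^ 2 = 1 / 2 → b ^ 2 = 1 / 2 →
      R (EuclideanSpace.single (0 : Fin 4) (1 : ℝ)) = a • EuclideanSpace.single (0 : Fin 4) (1 : ℝ) +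
        b • EuclideanSpace.single (1 : Fin 4) (1 : ℝ) →
      (∀ (N : ℕ) (deg : Fin N → ℕ) (g : (j : Fin N) → Fin (deg j) → 𝓢(EuclideanSpace ℝ (Fin 4), ℂ))
    (F : (j : Fin N) → 𝓢((Fin (deg j) → EuclideanSpace ℝ (Fin 4)), ℂ)),
    (∀ j, IsTensorOf (F j) (g j)) →
    (∀ j i, HasCompactSupport (g j i : EuclideanSpace ℝ (Fin 4) → ℂ) ∧
      tsupport (g j i : EuclideanSpace ℝ (Fin 4) → ℂ) ⊆ {x : EuclideanSpace ℝ (Fin 4) | 0 < x 0}) →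
    (∀ j i i', i ≠ i' → Disjoint (tsupport (g j i : EuclideanSpace ℝ (Fin 4) → ℂ))
      (tsupport (g j i' : EuclideanSpace ℝ (Fin 4) → ℂ))) →
    ∀ H : (i j : Fin N) → 𝓢((Fin (deg i + deg j) → EuclideanSpace ℝ (Fin 4)), ℂ),
      (∀ i j, IsAppendTensorOf (H i j) (osAdjoint (F i)) (F j)) →
        0 ≤ (∑ i, ∑ j, (fun m => (S₁ m).comp (linActMulti R)) (deg i + deg j) (H i j)).re ∧ (∑ i, ∑ j, (fun m => (S₁ m).comp (linActMulti R)) (deg i + deg j) (H i j)).im = 0))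
    {n v : EuclideanSpace ℝ (Fin 4)} (hnv : (∃ (μ ν : Fin 4) (s s' : ℝ), μ ≠ ν ∧ (s = 1 ∨ s = -1) ∧ (s' = 1 ∨ s' = -1) ∧
    n = (Real.sqrt 2)⁻¹ • (s • (EuclideanSpace.single μ (1 : ℝ) : EuclideanSpace ℝ (Fin 4)) +
      s' • (EuclideanSpace.single ν (1 : ℝ) : EuclideanSpace ℝ (Fin 4))) ∧
    v = (Real.sqrt 2)⁻¹ • (s • (EuclideanSpace.single μ (1 : ℝ) : EuclideanSpace ℝ (Fin 4)) -
      s' • (EuclideanSpace.single ν (1 : ℝ) : EuclideanSpace ℝ (Fin 4))))) :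
    ∃ R : EuclideanSpace ℝ (Fin 4) ≃ₗᵢ[ℝ] EuclideanSpace ℝ (Fin 4),
      R (EuclideanSpace.single 0 1) = n ∧ R (EuclideanSpace.single 1 1) = v ∧
      (∀ (f₁ f₂ q : 𝓢(EuclideanSpace ℝ (Fin 4), ℂ)), HasCompactSupport (f₁ : EuclideanSpace ℝ (Fin 4) → ℂ) →
    HasCompactSupport (f₂ : EuclideanSpace ℝ (Fin 4) → ℂ) → HasCompactSupport (q : EuclideanSpace ℝ (Fin 4) → ℂ) →
    tsupport (f₁ : EuclideanSpace ℝ (Fin 4) → ℂ) ⊆ {y | y 0 < 0} →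
    tsupport (f₂ : EuclideanSpace ℝ (Fin 4) → ℂ) ⊆ {y | y 0 < 0} →
    tsupport (q : EuclideanSpace ℝ (Fin 4) → ℂ) ⊆ {y | 0 < y 0} →
    Disjoint (tsupport (f₁ : EuclideanSpace ℝ (Fin 4) → ℂ)) (tsupport (f₂ : EuclideanSpace ℝ (Fin 4) → ℂ)) →
    ∀ lam mu : ℂ,
    0 ≤ (conj lam * lam * (fun m => (S₁ m).comp (linActMulti R)) 4 (SchwartzMap.tensorFin 4 ![f₁, f₂, starTest (thetaTest 4 f₂), starTest (thetaTest 4 f₁)]) +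
        conj lam * mu * (fun m => (S₁ m).comp (linActMulti R)) 3 (SchwartzMap.tensorFin 3 ![f₁, f₂, q]) +
        conj mu * lam * (fun m => (S₁ m).comp (linActMulti R)) 3 (SchwartzMap.tensorFin 3 ![starTest (thetaTest 4 q), starTest (thetaTest 4 f₂),
          starTest (thetaTest 4 f₁)]) +
        conj mu * mu * (fun m => (S₁ m).comp (linActMulti R)) 2 (SchwartzMap.tensorFin 2 ![starTest (thetaTest 4 q), q])).re ∧
      (conj lam * lam * (fun m => (S₁ m).comp (linActMulti R)) 4 (SchwartzMap.tensorFin 4 ![f₁, f₂, starTest (thetaTest 4 f₂), starTest (thetaTest 4 f₁)]) +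
        conj lam * mu * (fun m => (S₁ m).comp (linActMulti R)) 3 (SchwartzMap.tensorFin 3 ![f₁, f₂, q]) +
        conj mu * lam * (fun m => (S₁ m).comp (linActMulti R)) 3 (SchwartzMap.tensorFin 3 ![starTest (thetaTest 4 q), starTest (thetaTest 4 f₂),
          starTest (thetaTest 4 f₁)]) +
        conj mu * mu * (fun m => (S₁ m).comp (linActMulti R)) 2 (SchwartzMap.tensorFin 2 ![starTest (thetaTest 4 q), q])).im = 0) := by
  obtain ⟨μ, ν, s, s', hμν, hs, hs', rfl, rfl⟩ := hnv
  obtain ⟨R₀, hR₀, hR₁⟩ := exists_diagonal_frame₂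
  obtain ⟨P, hdet, hsign, h0, h1⟩ := exists_signedPerm_frame μ ν hμν hs hs'
  have hc : Real.sqrt (1 / 2) = (Real.sqrt 2)⁻¹ := by rw [one_div, Real.sqrt_inv]
  have hsq : Real.sqrt (1 / 2) ^ 2 = 1 / 2 := Real.sq_sqrt (by norm_num)
  refine ⟨R₀.trans P, ?_, ?_, ?_⟩
  · rw [LinearIsometryEquiv.trans_apply, hR₀, map_add, LinearIsometryEquiv.map_smul,
      LinearIsometryEquiv.map_smul, h0, h1, hc, smul_add]
  · rw [LinearIsometryEquiv.trans_apply, hR₁, map_sub, LinearIsometryEquiv.map_smul,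
      LinearIsometryEquiv.map_smul, h0, h1, hc, smul_sub]
  · have hP0 :=
      pairPSD_of_productRP (fun m => (S₁ m).comp (linActMulti R₀)) (hPRP R₀ _ _ hsq hsq hR₀)
    refine pairPSD_of_forall_isOffDiagonal_eq (S := fun m => (S₁ m).comp (linActMulti R₀))
      (S' := fun m => (S₁ m).comp (linActMulti (R₀.trans P))) (fun k F hF => ?_) hP0
    simp only [ContinuousLinearMap.comp_apply, linActMulti_trans]
    exact hhyp P hdet hsign k _ (isOffDiagonal_linActMulti R₀ hF)

/-- **Part 2 of stub B in every diagonal lattice frame**, given diagonal product reflection positivity: one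
Schwartz order `M₀` and, for every `N`, constants `C, p` such that for every diagonal frame `(n, v)`, mirror
level `c`, gap `δ ∈ (0,1]`, compactly supported DISJOINT `f₁, f₂` below the mirror, `g` beyond the gap and
`w ∈ {n, v}`: `|𝔖₃(f₁ ⊗ f₂ ⊗ ∂_wᴺ g)| ≤ C δ⁻ᵖ |f₁|_{M₀} |f₂|_{M₀} |g|_{M₀}`. [folklore] -/
theorem part_two (hpkg : OSPackage S₁) (htr : Translations S₁) (hhyp : Hypercubic S₁) (h8 : EightFrameRP S₁)
    (hPRP : ∀ (R : EuclideanSpace ℝ (Fin 4) ≃ₗᵢ[ℝ] EuclideanSpace ℝ (Fin 4)) (a b : ℝ), a ^ 2 = 1 / 2 → b ^ 2 = 1 / 2 →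
      R (EuclideanSpace.single (0 : Fin 4) (1 : ℝ)) = a • EuclideanSpace.single (0 : Fin 4) (1 : ℝ) +
        b • EuclideanSpace.single (1 : Fin 4) (1 : ℝ) →
      (∀ (N : ℕ) (deg : Fin N → ℕ) (g : (j : Fin N) → Fin (deg j) → 𝓢(EuclideanSpace ℝ (Fin 4), ℂ))
    (F : (j : Fin N) → 𝓢((Fin (deg j) → EuclideanSpace ℝ (Fin 4)), ℂ)),
    (∀ j, IsTensorOf (F j) (g j)) →
    (∀ j i, HasCompactSupport (g j i : EuclideanSpace ℝ (Fin 4) → ℂ) ∧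
      tsupport (g j i : EuclideanSpace ℝ (Fin 4) → ℂ) ⊆ {x : EuclideanSpace ℝ (Fin 4) | 0 < x 0}) →
    (∀ j i i', i ≠ i' → Disjoint (tsupport (g j i : EuclideanSpace ℝ (Fin 4) → ℂ))
      (tsupport (g j i' : EuclideanSpace ℝ (Fin 4) → ℂ))) →
    ∀ H : (i j : Fin N) → 𝓢((Fin (deg i + deg j) → EuclideanSpace ℝ (Fin 4)), ℂ),
      (∀ i j, IsAppendTensorOf (H i j) (osAdjoint (F i)) (F j)) →
        0 ≤ (∑ i, ∑ j, (fun m => (S₁ m).comp (linActMulti R)) (deg i + deg j) (H i j)).re ∧ (∑ i, ∑ j, (fun m => (S₁ m).comp (linActMulti R)) (deg i + deg j) (H i j)).im = 0)) :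
    ∃ M₀ : ℕ, ∀ N : ℕ, ∃ (C : ℝ) (p : ℕ), ∀ (n v : EuclideanSpace ℝ (Fin 4)), (∃ (μ ν : Fin 4) (s s' : ℝ), μ ≠ ν ∧ (s = 1 ∨ s = -1) ∧ (s' = 1 ∨ s' = -1) ∧
    n = (Real.sqrt 2)⁻¹ • (s • (EuclideanSpace.single μ (1 : ℝ) : EuclideanSpace ℝ (Fin 4)) +
      s' • (EuclideanSpace.single ν (1 : ℝ) : EuclideanSpace ℝ (Fin 4))) ∧
    v = (Real.sqrt 2)⁻¹ • (s • (EuclideanSpace.single μ (1 : ℝ) : EuclideanSpace ℝ (Fin 4)) -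
      s' • (EuclideanSpace.single ν (1 : ℝ) : EuclideanSpace ℝ (Fin 4)))) →
      ∀ δ : ℝ, 0 < δ → δ ≤ 1 → ∀ (c : ℝ) (f₁ f₂ g : 𝓢(EuclideanSpace ℝ (Fin 4), ℂ)),
        HasCompactSupport (f₁ : EuclideanSpace ℝ (Fin 4) → ℂ) → HasCompactSupport (f₂ : EuclideanSpace ℝ (Fin 4) → ℂ) →
        HasCompactSupport (g : EuclideanSpace ℝ (Fin 4) → ℂ) →
        tsupport (f₁ : EuclideanSpace ℝ (Fin 4) → ℂ) ⊆ {x | inner ℝ x n < c} →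
        tsupport (f₂ : EuclideanSpace ℝ (Fin 4) → ℂ) ⊆ {x | inner ℝ x n < c} →
        tsupport (g : EuclideanSpace ℝ (Fin 4) → ℂ) ⊆ {x | c + δ < inner ℝ x n} →
        Disjoint (tsupport (f₁ : EuclideanSpace ℝ (Fin 4) → ℂ)) (tsupport (f₂ : EuclideanSpace ℝ (Fin 4) → ℂ)) →
        ∀ w : EuclideanSpace ℝ (Fin 4), (w = n ∨ w = v) → ∀ F : 𝓢((Fin 3 → EuclideanSpace ℝ (Fin 4)), ℂ),
          IsTensorOf F ![f₁, f₂, ((LineDeriv.lineDerivOp w : 𝓢(EuclideanSpace ℝ (Fin 4), ℂ) →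
            𝓢(EuclideanSpace ℝ (Fin 4), ℂ))^[N] g)] →
            ‖S₁ 3 F‖ ≤ C * (1 / δ) ^ p * schwartzNorm M₀ f₁ * schwartzNorm M₀ f₂ * schwartzNorm M₀ g := by
  obtain ⟨M₂, C₂, hC₂, hS2⟩ := exists_norm_apply_le_schwartzNorm (S₁ 2)
  obtain ⟨M₄, C₄, hC₄, hS4⟩ := exists_norm_apply_le_schwartzNorm (S₁ 4)
  set M : ℕ := max M₂ M₄ with hM
  set AB : ℝ := Real.sqrt (|C₄| * (2 ^ (M₄ + 1)) ^ 4) *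
    Real.sqrt (2 * (|C₂| * (2 ^ (M₂ + 1)) ^ 2 * 16 ^ M₂)) with hAB
  refine ⟨M + 3 * M, fun N => ⟨(4 * N / Real.exp 1) ^ N * AB * ((2 : ℝ) ^ (3 * M) * 2 ^ (3 * M)), N, ?_⟩⟩
  intro n v hnv δ hδ hδ1 c f₁ f₂ g hf₁c hf₂c hgc hf₁ hf₂ hg hdis w hw F hF
  obtain ⟨R, hR0, hR1, hpsd⟩ := exists_frame_pairPSD S₁ hhyp hPRP hnv
  have hnv' : ((∃ (μ ν : Fin 4) (s s' : ℝ), μ ≠ ν ∧ (s = 1 ∨ s = -1) ∧ (s' = 1 ∨ s' = -1) ∧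
    n = s • (EuclideanSpace.single μ (1 : ℝ) : EuclideanSpace ℝ (Fin 4)) ∧
    v = s' • (EuclideanSpace.single ν (1 : ℝ) : EuclideanSpace ℝ (Fin 4))) ∨
  (∃ (μ ν : Fin 4) (s s' : ℝ), μ ≠ ν ∧ (s = 1 ∨ s = -1) ∧ (s' = 1 ∨ s' = -1) ∧
    n = (Real.sqrt 2)⁻¹ • (s • (EuclideanSpace.single μ (1 : ℝ) : EuclideanSpace ℝ (Fin 4)) +
      s' • (EuclideanSpace.single ν (1 : ℝ) : EuclideanSpace ℝ (Fin 4))) ∧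
    v = (Real.sqrt 2)⁻¹ • (s • (EuclideanSpace.single μ (1 : ℝ) : EuclideanSpace ℝ (Fin 4)) -
      s' • (EuclideanSpace.single ν (1 : ℝ) : EuclideanSpace ℝ (Fin 4))))) := Or.inr hnv
  obtain ⟨hR, hcone⟩ := frame_package S₁ hpkg htr hhyp h8 hnv' R hR0 hR1
  set SR : SchwingerFamily (EuclideanSpace ℝ (Fin 4)) := fun m => (S₁ m).comp (linActMulti R) with hSR
  set L : EuclideanSpace ℝ (Fin 4) ≃L[ℝ] EuclideanSpace ℝ (Fin 4) := R.toContinuousLinearEquiv with hL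
  set f₁R := SchwartzMap.compCLMOfContinuousLinearEquiv ℂ L f₁ with hf₁R
  set f₂R := SchwartzMap.compCLMOfContinuousLinearEquiv ℂ L f₂ with hf₂R
  set gR := SchwartzMap.compCLMOfContinuousLinearEquiv ℂ L g with hgR
  rw [← hR0] at hf₁ hf₂ hg
  have hf₁s : tsupport (f₁R : EuclideanSpace ℝ (Fin 4) → ℂ) ⊆ {y | y 0 < c} :=
    tsupport_compCLMOfContinuousLinearEquiv_subset_of_inner R (· < c) hf₁
  have hf₂s : tsupport (f₂R : EuclideanSpace ℝ (Fin 4) → ℂ) ⊆ {y | y 0 < c} :=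
    tsupport_compCLMOfContinuousLinearEquiv_subset_of_inner R (· < c) hf₂
  have hgs : tsupport (gR : EuclideanSpace ℝ (Fin 4) → ℂ) ⊆ {y | c + δ < y 0} :=
    tsupport_compCLMOfContinuousLinearEquiv_subset_of_inner R (fun t => c + δ < t) hg
  have hdisR : Disjoint (tsupport (f₁R : EuclideanSpace ℝ (Fin 4) → ℂ)) (tsupport (f₂R : EuclideanSpace ℝ (Fin 4) → ℂ)) :=
    Set.disjoint_left.2 fun y hy1 hy2 =>
      Set.disjoint_left.1 hdis (apply_mem_tsupport_of_mem_tsupport_compCLMOfContinuousLinearEquiv L f₁ hy1)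
        (apply_mem_tsupport_of_mem_tsupport_compCLMOfContinuousLinearEquiv L f₂ hy2)
  have hcpt : ∀ (φ : 𝓢(EuclideanSpace ℝ (Fin 4), ℂ)), HasCompactSupport (φ : EuclideanSpace ℝ (Fin 4) → ℂ) →
      HasCompactSupport ((SchwartzMap.compCLMOfContinuousLinearEquiv ℂ L φ : 𝓢(EuclideanSpace ℝ (Fin 4), ℂ)) :
        EuclideanSpace ℝ (Fin 4) → ℂ) := fun φ hφ =>
    hφ.comp_homeomorph L.toHomeomorph
  obtain ⟨w', hw', hLw⟩ : ∃ w' : EuclideanSpace ℝ (Fin 4), (w' = EuclideanSpace.single (0 : Fin 4) (1 : ℝ) ∨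
      w' = EuclideanSpace.single (1 : Fin 4) (1 : ℝ)) ∧ L w' = w := by
    rcases hw with rfl | rfl
    · exact ⟨_, Or.inl rfl, hR0⟩
    · exact ⟨_, Or.inr rfl, hR1⟩
  have hval : S₁ 3 F = SR 3 (SchwartzMap.tensorFin 3 ![f₁R, f₂R,
      ((∂_{w'} : 𝓢(EuclideanSpace ℝ (Fin 4), ℂ) → 𝓢(EuclideanSpace ℝ (Fin 4), ℂ))^[N]) gR]) := by
    rw [hF.unique (isTensorOf_tensorFin _), hgR, iterate_lineDerivOp_compCLMOfContinuousLinearEquiv, hLw, hSR]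
    simp only [ContinuousLinearMap.comp_apply]
    rw [hf₁R, hf₂R, hL, linActMulti_tensorFin_three_comp]
  have key := norm_three_point_standard_disjoint SR hR hcone hpsd M₂ C₂ (bound_frame S₁ R hC₂ hS2) (le_max_left _ _)
    M₄ C₄ (bound_frame S₁ R hC₄ hS4) (le_max_right _ _) N hδ hδ1 c f₁R f₂R gR (hcpt f₁ hf₁c) (hcpt f₂ hf₂c)
    (hcpt g hgc) hf₁s hf₂s hgs hdisR hw'
  rw [hval]
  refine key.trans ?_
  have hn1 : schwartzNorm (M + 3 * M) f₁R ≤ schwartzNorm (M + 3 * M) f₁ :=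
    schwartzNorm_compCLMOfContinuousLinearEquiv_isometry_le R _ f₁
  have hn2 : schwartzNorm (M + 3 * M) f₂R ≤ schwartzNorm (M + 3 * M) f₂ :=
    schwartzNorm_compCLMOfContinuousLinearEquiv_isometry_le R _ f₂
  have hn3 : schwartzNorm (M + 3 * M) gR ≤ schwartzNorm (M + 3 * M) g :=
    schwartzNorm_compCLMOfContinuousLinearEquiv_isometry_le R _ g
  have h02 := schwartzNorm_nonneg (M + 3 * M) f₂R
  have h03 := schwartzNorm_nonneg (M + 3 * M) gR
  have h0f₁ := schwartzNorm_nonneg (M + 3 * M) f₁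
  have h0f₂ := schwartzNorm_nonneg (M + 3 * M) f₂
  have hr : ((2 * N : ℕ) : ℝ) / (Real.exp 1 * (δ / 2)) = (4 * N / Real.exp 1) * (1 / δ) := ratio_eq N hδ
  rw [hr, mul_pow, ← hAB]
  have hK0 : 0 ≤ (4 * N / Real.exp 1) ^ N * (1 / δ) ^ N * AB * ((2 : ℝ) ^ (3 * M) * 2 ^ (3 * M)) := by positivity
  calc (4 * N / Real.exp 1) ^ N * (1 / δ) ^ N * AB * ((2 : ℝ) ^ (3 * M) * 2 ^ (3 * M)) *
        (schwartzNorm (M + 3 * M) f₁R * schwartzNorm (M + 3 * M) f₂R * schwartzNorm (M + 3 * M) gR)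
      ≤ (4 * N / Real.exp 1) ^ N * (1 / δ) ^ N * AB * ((2 : ℝ) ^ (3 * M) * 2 ^ (3 * M)) *
        (schwartzNorm (M + 3 * M) f₁ * schwartzNorm (M + 3 * M) f₂ * schwartzNorm (M + 3 * M) g) :=
        mul_le_mul_of_nonneg_left (mul_le_mul (mul_le_mul hn1 hn2 h02 h0f₁) hn3 h03 (mul_nonneg h0f₁ h0f₂)) hK0
    _ = _ := by ring

end PartTwo

end Summit.QuantumFields.YangMills.Theorems.TemperedCurvatureMoments.Sketch.ThreePointChartBounds

/-! ## The stub, by name -/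

namespace Summit.QuantumFields.YangMills.Theorems.TemperedCurvatureMoments.Sketch

open Summit.QuantumFields.YangMills.Theorems.CurvatureBoostCovariance.Negative
  (OSPackage Translations Hypercubic EightFrameRP PlanarCone)
open Summit.QuantumFields.YangMills.Theorems.NPointIsotropy.Negative (E4)

/-- **Stub B `stub_threePointChartBounds` (QFT → analysis interface of degree 3)** of reshape 4 of the
registered skeleton `Cruxes/TemperedCurvatureMoments/Lines/Sketch.lean` (crux stmt-QuantumFields-17721),
registered signature verbatim.  For a one-species family with the OS package, translations, proper signed
permutations, the eight planar frames and the planar cone: ONE Schwartz order `M₀` and, for every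
derivative order `N`, constants `C, p` (uniform over the finite frame menu) such that for every oriented
lattice frame `(n, v)`, every mirror level `c`, gap `δ ∈ (0,1]`, compactly supported `f₁, f₂` below the
mirror forming an `n`-ORDERED pair, `g` beyond the gap, and `w ∈ {n, v}`:
`‖𝔖₃(f₁ ⊗ f₂ ⊗ ∂_wᴺ g)‖ ≤ C δ⁻ᵖ |f₁|_{M₀} |f₂|_{M₀} |g|_{M₀}`; and, GIVEN diagonal product RP, the same in the
diagonal frames for a merely DISJOINT pair.  Proof (`ThreePointChartBounds.part_one/part_two`): in the
frame `R` (`R e₀ = n`, `R e₁ = v`) the pulled-back family has E2 (eight-frame RP transported by the proper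
signed permutations) and translations, hence an OS Hilbert space, and its joint spectral measures lie on
the planar cone (crux `PlanarSpectralCone`, support form); `|⟪Ψ_pair, Ψ_{∂ᴺg}⟫| ≤ ‖Ψ_pair‖ ‖Ψ_{∂ᴺg}‖`
(resp. the `2 × 2` Gram form from product RP), `‖Ψ_pair‖² ≤ C₄ |pair ⊗ θpair*|`, and
`‖Ψ_{∂_wᴺg}‖² = |𝔖₂(θḡ ⊗ ∂_w^{2N} g)| ≤ (4N/eδ)^{2N} K |g|²` by the semigroup/cone derivative bounds; the
mirror level is absorbed into the Schwartz weights.  The planar-cone hypothesis is not used (it is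
re-derived in every frame). [folklore] -/
theorem stub_threePointChartBounds :
    ∀ (S₁ : SchwingerFamily E4), OSPackage S₁ → Translations S₁ → Hypercubic S₁ → EightFrameRP S₁ → PlanarCone S₁ →
      (∃ M₀ : ℕ, ∀ N : ℕ, ∃ (C : ℝ) (p : ℕ), ∀ (n v : E4),
          ((∃ (μ ν : Fin 4) (s s' : ℝ), μ ≠ ν ∧ (s = 1 ∨ s = -1) ∧ (s' = 1 ∨ s' = -1) ∧
            n = s • (EuclideanSpace.single μ (1 : ℝ) : E4) ∧ v = s' • (EuclideanSpace.single ν (1 : ℝ) : E4)) ∨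
          (∃ (μ ν : Fin 4) (s s' : ℝ), μ ≠ ν ∧ (s = 1 ∨ s = -1) ∧ (s' = 1 ∨ s' = -1) ∧
            n = (Real.sqrt 2)⁻¹ • (s • (EuclideanSpace.single μ (1 : ℝ) : E4) + s' • (EuclideanSpace.single ν (1 : ℝ) : E4)) ∧
            v = (Real.sqrt 2)⁻¹ • (s • (EuclideanSpace.single μ (1 : ℝ) : E4) - s' • (EuclideanSpace.single ν (1 : ℝ) : E4)))) →
          ∀ δ : ℝ, 0 < δ → δ ≤ 1 → ∀ (c : ℝ) (f₁ f₂ g : 𝓢(E4, ℂ)),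
            HasCompactSupport (f₁ : E4 → ℂ) → HasCompactSupport (f₂ : E4 → ℂ) → HasCompactSupport (g : E4 → ℂ) →
            tsupport (f₁ : E4 → ℂ) ⊆ {x : E4 | inner ℝ x n < c} → tsupport (f₂ : E4 → ℂ) ⊆ {x : E4 | inner ℝ x n < c} →
            tsupport (g : E4 → ℂ) ⊆ {x : E4 | c + δ < inner ℝ x n} →
            (∃ c' : ℝ, (tsupport (f₁ : E4 → ℂ) ⊆ {x : E4 | inner ℝ x n < c'} ∧ tsupport (f₂ : E4 → ℂ) ⊆ {x : E4 | c' < inner ℝ x n}) ∨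
              (tsupport (f₂ : E4 → ℂ) ⊆ {x : E4 | inner ℝ x n < c'} ∧ tsupport (f₁ : E4 → ℂ) ⊆ {x : E4 | c' < inner ℝ x n})) →
            ∀ w : E4, (w = n ∨ w = v) → ∀ F : 𝓢((Fin 3 → E4), ℂ),
              IsTensorOf F ![f₁, f₂, ((LineDeriv.lineDerivOp w : 𝓢(E4, ℂ) → 𝓢(E4, ℂ))^[N] g)] →
                ‖S₁ 3 F‖ ≤ C * (1 / δ) ^ p * schwartzNorm M₀ f₁ * schwartzNorm M₀ f₂ * schwartzNorm M₀ g) ∧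
      ((∀ (R : E4 ≃ₗᵢ[ℝ] E4) (a b : ℝ), a ^ 2 = 1 / 2 → b ^ 2 = 1 / 2 →
        R (EuclideanSpace.single (0 : Fin 4) (1 : ℝ)) = a • EuclideanSpace.single (0 : Fin 4) (1 : ℝ) + b • EuclideanSpace.single (1 : Fin 4) (1 : ℝ) →
        (∀ (N : ℕ) (deg : Fin N → ℕ) (g : (j : Fin N) → Fin (deg j) → 𝓢(E4, ℂ))
          (F : (j : Fin N) → 𝓢((Fin (deg j) → E4), ℂ)),
          (∀ j, IsTensorOf (F j) (g j)) →
          (∀ j i, HasCompactSupport (g j i : E4 → ℂ) ∧ tsupport (g j i : E4 → ℂ) ⊆ {x : E4 | 0 < x 0}) →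
          (∀ j i i', i ≠ i' → Disjoint (tsupport (g j i : E4 → ℂ)) (tsupport (g j i' : E4 → ℂ))) →
          ∀ H : (i j : Fin N) → 𝓢((Fin (deg i + deg j) → E4), ℂ),
            (∀ i j, IsAppendTensorOf (H i j) (osAdjoint (F i)) (F j)) →
              0 ≤ (∑ i, ∑ j, (fun m => (S₁ m).comp (linActMulti R)) (deg i + deg j) (H i j)).re ∧ (∑ i, ∑ j, (fun m => (S₁ m).comp (linActMulti R)) (deg i + deg j) (H i j)).im = 0)) →
        ∃ M₀ : ℕ, ∀ N : ℕ, ∃ (C : ℝ) (p : ℕ), ∀ (n v : E4),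
          (∃ (μ ν : Fin 4) (s s' : ℝ), μ ≠ ν ∧ (s = 1 ∨ s = -1) ∧ (s' = 1 ∨ s' = -1) ∧
            n = (Real.sqrt 2)⁻¹ • (s • (EuclideanSpace.single μ (1 : ℝ) : E4) + s' • (EuclideanSpace.single ν (1 : ℝ) : E4)) ∧
            v = (Real.sqrt 2)⁻¹ • (s • (EuclideanSpace.single μ (1 : ℝ) : E4) - s' • (EuclideanSpace.single ν (1 : ℝ) : E4))) →
          ∀ δ : ℝ, 0 < δ → δ ≤ 1 → ∀ (c : ℝ) (f₁ f₂ g : 𝓢(E4, ℂ)),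
            HasCompactSupport (f₁ : E4 → ℂ) → HasCompactSupport (f₂ : E4 → ℂ) → HasCompactSupport (g : E4 → ℂ) →
            tsupport (f₁ : E4 → ℂ) ⊆ {x : E4 | inner ℝ x n < c} → tsupport (f₂ : E4 → ℂ) ⊆ {x : E4 | inner ℝ x n < c} →
            tsupport (g : E4 → ℂ) ⊆ {x : E4 | c + δ < inner ℝ x n} →
            Disjoint (tsupport (f₁ : E4 → ℂ)) (tsupport (f₂ : E4 → ℂ)) →
            ∀ w : E4, (w = n ∨ w = v) → ∀ F : 𝓢((Fin 3 → E4), ℂ),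
              IsTensorOf F ![f₁, f₂, ((LineDeriv.lineDerivOp w : 𝓢(E4, ℂ) → 𝓢(E4, ℂ))^[N] g)] →
                ‖S₁ 3 F‖ ≤ C * (1 / δ) ^ p * schwartzNorm M₀ f₁ * schwartzNorm M₀ f₂ * schwartzNorm M₀ g) := by
  intro S₁ hpkg htr hhyp h8 _
  refine ⟨?_, fun hPRP => ?_⟩
  · obtain ⟨M₀, hM⟩ := ThreePointChartBounds.part_one S₁ hpkg htr hhyp h8
    refine ⟨M₀, fun N => ?_⟩
    obtain ⟨C, p, hCp⟩ := hM N
    exact ⟨C, p, fun n v hnv δ hδ hδ1 c f₁ f₂ g _ _ _ hf₁ hf₂ hg hord w hw F hF =>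
      hCp n v hnv δ hδ hδ1 c f₁ f₂ g hf₁ hf₂ hg hord w hw F hF⟩
  · obtain ⟨M₀, hM⟩ := ThreePointChartBounds.part_two S₁ hpkg htr hhyp h8 hPRP
    refine ⟨M₀, fun N => ?_⟩
    obtain ⟨C, p, hCp⟩ := hM N
    exact ⟨C, p, fun n v hnv => hCp n v hnv⟩

end Summit.QuantumFields.YangMills.Theorems.TemperedCurvatureMoments.Sketch

end
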